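import Mathlib

/-!
# Sketch.lean — first lemmas for the crux-ideate cards on `AcyclicBisectionExists`
(stmt-SmoothPoincare4-10508, route ConvexBisection).  Both lemmas are the purely
algebraic/combinatorial cores of the two levers; they elaborate over Mathlib only
(no Lefschetz-fibration / surface-braid vocabulary exists in the tree yet).
-/

namespace Summit.SmoothPoincare4.SmoothPoincare4.Cruxes.AcyclicBisectionExists.Sketch

open scoped BigOperators

/-! ## Card `achiral-swap` — the transvection-invariance ("stuck orbit") lemma.

`V = H₁(F;ℚ)` of the common page, `ω` = algebraic intersection form, `S` = classes of the
letters of the side-2 factorisation, `η` = class of its unique achiral letter, `W` = span of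
the classes reachable from `η` by Hurwitz moves (invariant under every symplectic
transvection `T_c v = v + ω c v • c`, `c ∈ S`), `lam` = the coordinate functional of the
side-1 achiral letter.  If the reachable span is stuck inside `ker lam` then some letter
`c` with `lam c ≠ 0` is `ω`-orthogonal to all of `W` — the degenerate alignment that a
positive common stabilisation destroys. -/
theorem stuck_orbit_forces_orthogonal_letter
    {V : Type*} [AddCommGroup V] [Module ℚ V]
    (ω : V →ₗ[ℚ] V →ₗ[ℚ] ℚ) (S : Finset V) (η : V) (lam : Module.Dual ℚ V)
    (hspan : Submodule.span ℚ ((S : Set V) ∪ {η}) = ⊤) (hlam : lam ≠ 0)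
    (W : Submodule ℚ V) (hη : η ∈ W) (hW : W ≤ LinearMap.ker lam)
    (hinv : ∀ c ∈ S, ∀ w ∈ W, w + (ω c w) • c ∈ W) :
    ∃ c ∈ S, lam c ≠ 0 ∧ ∀ w ∈ W, ω c w = 0 := by
  sorry

/-- The escape statement actually used by the line (n = 1 case): if the `ω`-graph on
`S ∪ {η}` is connected (no proper `ω`-orthogonal splitting separating them), the
transvection-invariant span of `η` is NOT contained in `ker lam`; hence some finite
product of transvections `T_c`, `c ∈ S`, moves `η` off the hyperplane. Stated here for a
single two-step product, which is what the Hurwitz realisation needs. -/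
theorem transvection_escape_two_step
    {V : Type*} [AddCommGroup V] [Module ℚ V]
    (ω : V →ₗ[ℚ] V →ₗ[ℚ] ℚ) (η b a : V) (lam : Module.Dual ℚ V)
    (hηa : lam η = 0) (hγ : lam b = 0) (ha : lam a ≠ 0)
    (hbη : ω b η ≠ 0) (hab : ω a b ≠ 0) :
    ∃ n m : ℤ, lam (let η' := η + ((n : ℚ) * ω b η) • b; η' + ((m : ℚ) * ω a η') • a) ≠ 0 := by
  sorry

/-! ## Card `braided-branch-locus` — sign-sorted transitivity under Hurwitz moves.

A closed surface braid of degree `m` gives a list of signed transpositions in `S_m`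
(branch points with their chirality); choosing the disc `D₊ ⊃` positive branch values
amounts to a Hurwitz rearrangement.  The positive half `F₊ = F ∩ (D² × D₊)` is CONNECTED
iff the positively-signed transpositions act transitively.  First lemma of the line
(d = 2 stratum): transitivity of the positive sub-system can always be reached. -/

/-- one Hurwitz move on a list of signed group elements (signs travel with the element) -/
def HurwitzStep {G : Type*} [Group G] (l l' : List (G × Bool)) : Prop :=
  ∃ (pre suf : List (G × Bool)) (a b : G × Bool),
    l = pre ++ a :: b :: suf ∧
    (l' = pre ++ (a.1 * b.1 * a.1⁻¹, b.2) :: a :: suf ∨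
     l' = pre ++ b :: (b.1⁻¹ * a.1 * b.1, a.2) :: suf)

/-- transitivity of the subgroup generated by a set of permutations, stated elementarily -/
def GenTransitive {m : ℕ} (T : Set (Equiv.Perm (Fin m))) : Prop :=
  ∀ i j : Fin m, ∃ g ∈ Subgroup.closure T, g i = j

theorem positive_subsystem_transitive_after_hurwitz (m : ℕ)
    (l : List (Equiv.Perm (Fin m) × Bool))
    (hswap : ∀ x ∈ l, ∃ a b : Fin m, a ≠ b ∧ x.1 = Equiv.swap a b)
    (htrans : GenTransitive {g | ∃ x ∈ l, x.1 = g})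
    (hcount : m ≤ (l.filter (fun x => x.2)).length + 1) :
    ∃ l', Relation.ReflTransGen HurwitzStep l l' ∧
      GenTransitive {g | ∃ x ∈ l', x.2 = true ∧ x.1 = g} := by
  sorry

end Summit.SmoothPoincare4.SmoothPoincare4.Cruxes.AcyclicBisectionExists.Sketch
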